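import Summits.Langlands.Langlands.Theorems.PicardMuOrdinaryMuOrdinaryFamilyRTThorneCompanionAut
import Literature.NumberTheory.GaloisRepresentations.CyclotomicCharacterArtinNorm
import Literature.NumberTheory.GaloisRepresentations.ToLocalRestrictField
import Literature.NumberTheory.GaloisRepresentations.LocalArtinMapNormCompatible
import Literature.NumberTheory.GaloisRepresentations.WeilGroupRestrictProofs
import Literature.NumberTheory.GaloisRepresentations.LocalGaloisGroupInertiaProofs
import HarnessLib

/-!
# PA-I glue H5 = G8: transport of an ordinary labelled weight along `F'_w ↝ L_u` with EXACT
# characters and CANONICAL Artin data (stub of `stub_thorneInputOverL`, line thorne-minimal-lift)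

Crux `Summit.Langlands.Langlands.Theses.PicardMuOrdinary.MuOrdinaryFamilyRT`, line
thorne-minimal-lift.  In the assembly of the Galois input of Thorne's Thm 5.1 over the soluble CM
extension `L/F'` (`stub_thorneInputOverL`), the point representation `ρ : Γ_{F'} → GL₃(ℚ̄₃)` is, at a
place `w ∣ 3` of `F'`, conjugate to an upper triangular representation of `Γ_{F'_w}` whose `i`-th
diagonal character equals `ordinaryWeightUnit λ i ∘ Art_{F'_w}⁻¹ = ∏_τ τ(Art⁻¹ ·)^{-(λ_{τ,3-i} + i)}`
on `I_{F'_w} ∩ U` for an open `U ≤ Γ_{F'_w}`; and `L` is chosen (CHT 2008, Lemma 4.1.2) so that at a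
place `u ∣ w` the whole of `Γ_{L_u}` restricts into `U` along the local base change `F'_w → L_u`
(`adicCompletionOfLiesOver`).  H5 = G8 produces the labelled weight `λ_L` of `L_u`
(`λ_L(τ') := λ(τ'|_{F'_w})`, restriction of the label `τ' : L_u → ℚ̄₃` along the continuous
`F'_w → L_u`) such that `ρ|_{Γ_L}` is, at `u`, conjugate to an upper triangular representation whose
diagonal characters are EXACTLY `ordinaryWeightUnit λ_L i ∘ Art_{L_u}⁻¹` on ALL of `I_{L_u}` (the
hypothesis of Gee–Geraghty 2012 Lemma 3.1.4 (3)), and `λ_L` is dominant and regular when `λ` has gaps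
`≥ 2`.  Ingredients:

* § 1 `prod_algHom_unitsMap_zpow_eq` — the LABEL/NORM IDENTITY at the level of `k`-embeddings:
  for a tower of fields `k ⊆ F ⊆ E` (finite, `E/F` separable), an algebraically closed `A ⊇ k`,
  exponents `a : Hom_k(F, A) → ℤ` and `u ∈ Eˣ`,
  `∏_{σ' : E → A} σ'(u)^{a(σ'|_F)} = ∏_{σ : F → A} σ(N_{E/F} u)^{a(σ)}` — group the `σ'` by their
  restriction `σ` (Mathlib `algHomEquivSigma`) and use `σ(N_{E/F} u) = ∏_{σ' ∣ σ} σ'(u)`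
  (Mathlib `Algebra.norm_eq_prod_embeddings` for the `F`-algebra `A` via `σ`);
* § 2 `ordinaryWeightUnit_unitsMap_norm` — the same for the tree's labels
  (`HodgeTateLabel = (· →A[ℤ] ℚ̄_ℓ)`, in bijection with `ℚ_ℓ`-embeddings by
  `HodgeTateLabel.equivPadicAlgHom`): `ordinaryWeightUnit λ i (N_{E/F} u) = ordinaryWeightUnit λ_E i u`
  with `λ_E(τ') = λ(τ' ∘ (F → E))`;
* § 3 `ordinaryWeight_transport_exact` (H5 = G8, registered): `F := F'_w`, `E := L_u` with their
  canonical `ℚ₃`-structures (`LocalField.padicAlgebra`, a scalar tower with `F → E` by uniqueness of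
  continuous `ℚ₃ → E`, `LocalField.eq_padicRingHom_of_continuous`); dominance/regularity of `λ_L` from
  the gaps of `λ` (labels of `L_u` exist: `IsAlgClosed.lift`); the two routes `Γ_{L_u} → Γ_{F'}` differ
  by a change of frame `ρ(t)` (`exists_toLocal_restrictField_eq_conj`), so in the frame `g ρ(t)⁻¹` the
  localisation of `ρ|_{Γ_L}` at `u` is the restriction of `g ρ|_{Γ_{F'_w}} g⁻¹` along
  `res : Γ_{L_u} → Γ_{F'_w}`: upper triangular, and on `τ ∈ I_{L_u}` (`res τ ∈ I_{F'_w} ∩ U`,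
  `absInertia_map_absGaloisRestrict_le_holds`) its `i`-th diagonal entry is
  `ordinaryWeightUnit λ i (Art_{F'_w}⁻¹(res τ)) = ordinaryWeightUnit λ i (N_{L_u/F'_w} Art_{L_u}⁻¹(τ))`
  (norm functoriality of THE local Artin maps, `LocalArtinData.IsCanonical.isCompatible`)
  `= ordinaryWeightUnit λ_L i (Art_{L_u}⁻¹ τ)` (§ 2).

References: T. Gee, D. Geraghty, Duke Math. J. 161 (2012), Def. 3.1.2 and Lemma 3.1.4; J.-P. Serre,
*Local Fields* (1979), Ch. XIII §4 Prop. 10 (norm functoriality); J.-P. Serre, *Abelian ℓ-adic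
representations* (1968), Ch. I §2.1; L. Clozel, M. Harris, R. Taylor, Publ. Math. IHÉS 108 (2008),
Lemma 4.1.2.  No named fact, no definition.
-/

set_option linter.dupNamespace false -- `Summit.Langlands.Langlands.…` is the problem's namespace

namespace Summit.Langlands.Langlands.Cruxes.MuOrdinaryFamilyRT.ThorneMinimalLift

open scoped NumberField Polynomial Matrix Classical
open Field IsDedekindDomain Polynomial
open Literature.NumberTheory.GaloisRepresentations Literature.NumberTheory.Automorphic
open Summit.Langlands.Langlands.Cruxes.MuOrdinaryFamilyRT.CharZeroDominance

noncomputable section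

/-! ## 1. The label/norm identity for `k`-embeddings -/

section Embeddings

variable {k F E A : Type*} [Field k] [Field F] [Field E] [Field A]
  [Algebra k F] [Algebra k E] [Algebra F E] [IsScalarTower k F E] [Algebra k A]
  [FiniteDimensional k F] [FiniteDimensional k E] [FiniteDimensional F E]
  [Algebra.IsSeparable F E] [IsAlgClosed A]

/-- **Label/norm identity for embeddings.**  For a tower of fields `k ⊆ F ⊆ E` with `E/k` finite and
`E/F` separable, an algebraically closed `k`-algebra `A`, exponents `a : Hom_k(F, A) → ℤ` and `u ∈ Eˣ`:
`∏_{σ' ∈ Hom_k(E, A)} σ'(u)^{a(σ'|_F)} = ∏_{σ ∈ Hom_k(F, A)} σ(N_{E/F} u)^{a(σ)}` in `Aˣ` — the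
`σ' : E → A` are grouped according to their restriction `σ = σ'|_F` (Mathlib `algHomEquivSigma`), and
for each `σ` the product of `σ'(u)` over the `[E:F]` extensions `σ'` of `σ` is `σ(N_{E/F} u)` (Mathlib
`Algebra.norm_eq_prod_embeddings`, for `A` an `F`-algebra through `σ`). -/
theorem prod_algHom_unitsMap_zpow_eq (a : (F →ₐ[k] A) → ℤ) (u : Eˣ) :
    ∏ σ' : E →ₐ[k] A, Units.map (σ' : E →* A) u ^ a (AlgHom.restrictDomain F σ') =
      ∏ σ : F →ₐ[k] A, Units.map (σ : F →* A) (Units.map (Algebra.norm F : E →* F) u) ^ a σ := by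
  rw [Fintype.prod_equiv (algHomEquivSigma (B := F))
      (fun σ' : E →ₐ[k] A => Units.map (σ' : E →* A) u ^ a (AlgHom.restrictDomain F σ'))
      (fun p => Units.map (((algHomEquivSigma (B := F)).symm p : E →ₐ[k] A) : E →* A) u ^
        a (AlgHom.restrictDomain F ((algHomEquivSigma (B := F)).symm p : E →ₐ[k] A)))
      (fun σ' => by simp),
    ← Finset.univ_sigma_univ, Finset.prod_sigma]
  refine Finset.prod_congr rfl fun σ _ => ?_
  letI : Algebra F A := σ.toRingHom.toAlgebra
  have hres : ∀ ψ : E →ₐ[F] A,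
      AlgHom.restrictDomain F ((algHomEquivSigma (B := F)).symm ⟨σ, ψ⟩ : E →ₐ[k] A) = σ :=
    fun ψ => congrArg Sigma.fst (Equiv.apply_symm_apply (algHomEquivSigma (B := F)) ⟨σ, ψ⟩)
  simp_rw [hres]
  rw [Finset.prod_zpow]
  congr 1
  ext
  simp only [Units.coe_prod, Units.coe_map, MonoidHom.coe_coe]
  change ∏ ψ : E →ₐ[F] A, (((algHomEquivSigma (B := F)).symm ⟨σ, ψ⟩ : E →ₐ[k] A) : E →* A) (u : E) =
    algebraMap F A (Algebra.norm F (u : E))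
  rw [Algebra.norm_eq_prod_embeddings F A (u : E)]
  exact Finset.prod_congr rfl fun ψ _ => rfl

end Embeddings

/-! ## 2. The label/norm identity for `ordinaryWeightUnit` -/

section Labels

variable {F E : Type*} [Field F] [TopologicalSpace F] [Field E] [TopologicalSpace E]
  {ℓ : ℕ} [Fact ℓ.Prime] [Algebra ℚ_[ℓ] F] [Algebra ℚ_[ℓ] E] [Algebra F E] [IsScalarTower ℚ_[ℓ] F E]
  [IsTopologicalRing F] [T2Space F] [FiniteDimensional ℚ_[ℓ] F]
  [IsTopologicalRing E] [T2Space E] [FiniteDimensional ℚ_[ℓ] E] {n : ℕ}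

/-- **Label/norm identity for `ordinaryWeightUnit`.**  Let `ℚ_ℓ ⊆ F ⊆ E` be finite, `F`, `E`
Hausdorff topological fields with continuous structure maps.  For a labelled weight `λ` of `F` put
`λ_E(τ') := λ(τ'|_F)`, the restriction `τ'|_F = τ' ∘ (F → E)` of the label `τ' : E → ℚ̄_ℓ` being the
label of the restricted `ℚ_ℓ`-embedding (`HodgeTateLabel.equivPadicAlgHom`, `AlgHom.restrictDomain`,
`HodgeTateLabel.ofPadicAlgHom`).  Then for every row `i` and `u ∈ Eˣ`:
`ordinaryWeightUnit λ i (N_{E/F} u) = ordinaryWeightUnit λ_E i u`, i.e.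
`∏_{τ} τ(N_{E/F} u)^{-(λ_{τ,n-i}+i)} = ∏_{τ'} τ'(u)^{-(λ_{τ'|F,n-i}+i)}` — § 1 transported along
`HodgeTateLabel.equivPadicAlgHom` (labels = `ℚ_ℓ`-embeddings). -/
theorem ordinaryWeightUnit_unitsMap_norm (hcF : Continuous (algebraMap ℚ_[ℓ] F))
    (hcE : Continuous (algebraMap ℚ_[ℓ] E)) (wt : LabelledWeight F (PadicAlgCl ℓ) n) (i : Fin n) (u : Eˣ) :
    ordinaryWeightUnit wt i (Units.map (Algebra.norm F : E →* F) u) =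
      ordinaryWeightUnit (fun τ' : HodgeTateLabel E (PadicAlgCl ℓ) => wt (HodgeTateLabel.ofPadicAlgHom hcF
        (AlgHom.restrictDomain F (HodgeTateLabel.equivPadicAlgHom hcE τ')))) i u := by
  haveI : CharZero F := charZero_of_injective_algebraMap (algebraMap ℚ_[ℓ] F).injective
  haveI : FiniteDimensional F E := Module.Finite.of_restrictScalars_finite ℚ_[ℓ] F E
  haveI : Algebra.IsSeparable F E := Algebra.IsSeparable.of_integral F E
  haveI := HodgeTateLabel.finite_of_continuous_algebraMap hcF
  haveI := HodgeTateLabel.finite_of_continuous_algebraMap hcE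
  letI := Fintype.ofFinite (HodgeTateLabel F (PadicAlgCl ℓ))
  letI := Fintype.ofFinite (HodgeTateLabel E (PadicAlgCl ℓ))
  set a : (F →ₐ[ℚ_[ℓ]] PadicAlgCl ℓ) → ℤ :=
    fun σ => -(wt (HodgeTateLabel.ofPadicAlgHom hcF σ) i.rev + (i : ℤ)) with ha
  simp only [ordinaryWeightUnit_apply, finprod_eq_prod_of_fintype]
  rw [Fintype.prod_equiv (HodgeTateLabel.equivPadicAlgHom hcF)
      (fun τ => Units.map (τ : F →* PadicAlgCl ℓ) (Units.map (Algebra.norm F : E →* F) u) ^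
        (-(wt τ i.rev + (i : ℤ))))
      (fun σ => Units.map (σ : F →* PadicAlgCl ℓ) (Units.map (Algebra.norm F : E →* F) u) ^ a σ) ?_,
    Fintype.prod_equiv (HodgeTateLabel.equivPadicAlgHom hcE)
      (fun τ' => Units.map (τ' : E →* PadicAlgCl ℓ) u ^ (-(wt (HodgeTateLabel.ofPadicAlgHom hcF
        (AlgHom.restrictDomain F (HodgeTateLabel.equivPadicAlgHom hcE τ'))) i.rev + (i : ℤ))))
      (fun σ' => Units.map (σ' : E →* PadicAlgCl ℓ) u ^ a (AlgHom.restrictDomain F σ')) fun _ => rfl]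
  · exact (prod_algHom_unitsMap_zpow_eq a u).symm
  · intro τ
    have h1 : HodgeTateLabel.ofPadicAlgHom hcF (HodgeTateLabel.equivPadicAlgHom hcF τ) = τ :=
      (HodgeTateLabel.equivPadicAlgHom hcF).symm_apply_apply τ
    simp only [ha, h1]
    rfl

end Labels

/-! ## 3. H5 = G8: transport of the ordinary weight along `F'_w ↝ L_u` -/

open Literature.NumberTheory.GaloisRepresentations.IsNonarchimedeanLocalField in
/-- **H5 = G8** (PA-I glue of `stub_thorneInputOverL`).  Let `𝓐` be a family of CANONICAL local
Artin data at the finite places of all number fields, `L ⊇ F'` number fields, `u ∣ w ∣ 3` places and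
`λ` a labelled weight of `F'_w` (`wt`).  There is a labelled weight `λ_L` of `L_u` (namely
`λ_L(τ') = λ(τ' ∘ (F'_w → L_u))`) such that (a) if `λ` has gaps `λ_{τ,i} ≥ λ_{τ,j} + 2` (`i < j`) then
`λ_L` is dominant and regular (labels of `L_u` exist), and (b) for every `ρ : Γ_{F'} → GL₃(ℚ̄₃)` and open
`U ≤ Γ_{F'_w}` such that `ρ|_{Γ_{F'_w}}` is conjugate to an upper triangular representation with `i`-th
diagonal entry `ordinaryWeightUnit λ i (Art_{F'_w}⁻¹ τ)` for `τ ∈ I_{F'_w}` with image in `U`, and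
`res_{F'_w}^{L_u}(Γ_{L_u}) ⊆ U`: `(ρ|_{Γ_L})|_{Γ_{L_u}}` is conjugate to an upper triangular representation
with `i`-th diagonal entry EXACTLY `ordinaryWeightUnit λ_L i (Art_{L_u}⁻¹ τ)` for ALL `τ ∈ I_{L_u}` —
change of frame `exists_toLocal_restrictField_eq_conj`, `res(I_{L_u}) ⊆ I_{F'_w}`, norm functoriality
of THE Artin maps (`LocalArtinData.IsCanonical.isCompatible`) and the label/norm identity § 2. -/
theorem ordinaryWeight_transport_exact : ∀ (𝓐 : ∀ (K : Type) [Field K] [NumberField K] (v : HeightOneSpectrum (𝓞 K)), LocalArtinData (v.adicCompletion K)), (∀ (K : Type) [Field K] [NumberField K] (v : HeightOneSpectrum (𝓞 K)), (𝓐 K v).IsCanonical) → ∀ (F' : Type) [Field F'] [NumberField F'] (L : Type) [Field L] [NumberField L] [Algebra F' L] (w : HeightOneSpectrum (𝓞 F')) (u : HeightOneSpectrum (𝓞 L)) (_ : u.asIdeal.LiesOver w.asIdeal) (_ : ((3 : ℕ) : 𝓞 F') ∈ w.asIdeal) (wt : LabelledWeight (w.adicCompletion F') (PadicAlgCl 3)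 3), ∃ wtL : LabelledWeight (u.adicCompletion L) (PadicAlgCl 3) 3, ((∀ τ (i j : Fin 3), i < j → wt τ j + 2 ≤ wt τ i) → wtL.IsDominant ∧ ∀ i j : Fin 3, (i : ℕ) + 1 = j → ∃ τ' : HodgeTateLabel (u.adicCompletion L) (PadicAlgCl 3), wtL τ' j < wtL τ' i) ∧ ∀ (ρ : FramedGaloisRep F' (PadicAlgCl 3) 3) (U : OpenSubgroup (absoluteGaloisGroup (w.adicCompletion F'))), (∃ g : GL (Fin 3) (PadicAlgCl 3), FramedRep.IsUpperTriangular ((ρ.toLocal w).conj g) ∧ ∀ τw ∈ WeilGroup.inertia (w.adicCompletion F'), WeilGroup.toAbsGalois (w.adicCompletion F') τw ∈ U → ∀ i : Fin 3, FramedRep.diagEntry ((ρ.toLocal w).conj g) i (WeilGroup.toAbsGalois (w.adicCompletion F') τw) = (ordinaryWeightUnit wt i ((𝓐 F' w).artin τw) : PadicAlgCl 3)) → (letI := (adicCompletionOfLiesOver F' L w u).toAlgebra; ∀ τ : absoluteGaloisGroup (u.adicCompletion L), absGaloisRestrict (w.adicCompletion F') (u.adicCompletion L) τ ∈ U) → ∃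 g : GL (Fin 3) (PadicAlgCl 3), FramedRep.IsUpperTriangular (((ρ.restrictField L).toLocal u).conj g) ∧ ∀ τw ∈ WeilGroup.inertia (u.adicCompletion L), ∀ i : Fin 3, FramedRep.diagEntry (((ρ.restrictField L).toLocal u).conj g) i (WeilGroup.toAbsGalois (u.adicCompletion L) τw) = (ordinaryWeightUnit wtL i ((𝓐 L u).artin τw) : PadicAlgCl 3) := by
  intro 𝓐 h𝓐 F' _ _ L _ _ _ w u hu hw3 wt
  -- ### the local fields `F := F'_w`, `E := L_u`, the tower `ℚ₃ ⊆ F ⊆ E`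
  letI := (adicCompletionOfLiesOver F' L w u).toAlgebra
  haveI := isScalarTower_adicCompletionOfLiesOver (F := F') (E := L) w u
  haveI : CharZero (w.adicCompletion F') := LocalField.charZero_adicCompletion w
  haveI : CharZero (u.adicCompletion L) := LocalField.charZero_adicCompletion u
  have hu3 : ((3 : ℕ) : 𝓞 L) ∈ u.asIdeal := (natCast_mem_asIdeal_iff_of_liesOver w u 3).2 hw3
  have hF := LocalField.valuation_adicCompletion_natCast_lt_one w 3 hw3
  have hE := LocalField.valuation_adicCompletion_natCast_lt_one u 3 hu3
  letI := LocalField.padicAlgebra (w.adicCompletion F') 3 hF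
  letI := LocalField.padicAlgebra (u.adicCompletion L) 3 hE
  have hcF := LocalField.continuous_algebraMap_padicAlgebra (w.adicCompletion F') 3 hF
  have hcE := LocalField.continuous_algebraMap_padicAlgebra (u.adicCompletion L) 3 hE
  have hφ : Continuous (algebraMap (w.adicCompletion F') (u.adicCompletion L)) :=
    continuous_adicCompletionOfLiesOver F' L w u
  haveI : IsScalarTower ℚ_[3] (w.adicCompletion F') (u.adicCompletion L) :=
    IsScalarTower.of_algebraMap_eq' (LocalField.eq_padicRingHom_of_continuous (u.adicCompletion L) 3 hE
      ((algebraMap (w.adicCompletion F') (u.adicCompletion L)).comp (algebraMap ℚ_[3] (w.adicCompletion F')))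
      (hφ.comp hcF)).symm
  haveI : FiniteDimensional ℚ_[3] (w.adicCompletion F') :=
    Literature.NumberTheory.PAdicHodge.finiteDimensional_padicAlgebra hF
  haveI : FiniteDimensional ℚ_[3] (u.adicCompletion L) :=
    Literature.NumberTheory.PAdicHodge.finiteDimensional_padicAlgebra hE
  haveI : FiniteDimensional (w.adicCompletion F') (u.adicCompletion L) :=
    Module.Finite.of_restrictScalars_finite ℚ_[3] (w.adicCompletion F') (u.adicCompletion L)
  haveI : ValuativeExtension (w.adicCompletion F') (u.adicCompletion L) :=
    valuativeExtension_of_cast_residueFieldCard_eq_zero cast_residueFieldCard_eq_zero_of_algebra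
  -- ### the transported weight `λ_L(τ') = λ(τ'|_{F'_w})`
  refine ⟨fun τ' => wt (HodgeTateLabel.ofPadicAlgHom hcF (AlgHom.restrictDomain (w.adicCompletion F')
    (HodgeTateLabel.equivPadicAlgHom hcE τ'))), fun hgap => ⟨fun τ' i j hij => ?_, fun i j hij => ?_⟩, ?_⟩
  · -- dominance
    show wt (HodgeTateLabel.ofPadicAlgHom hcF (AlgHom.restrictDomain (w.adicCompletion F')
        (HodgeTateLabel.equivPadicAlgHom hcE τ'))) j ≤
      wt (HodgeTateLabel.ofPadicAlgHom hcF (AlgHom.restrictDomain (w.adicCompletion F')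
        (HodgeTateLabel.equivPadicAlgHom hcE τ'))) i
    rcases hij.lt_or_eq with hlt | rfl
    · have := hgap (HodgeTateLabel.ofPadicAlgHom hcF (AlgHom.restrictDomain (w.adicCompletion F')
        (HodgeTateLabel.equivPadicAlgHom hcE τ'))) i j hlt
      omega
    · exact le_rfl
  · -- regularity: labels of `L_u` exist
    have σ' : u.adicCompletion L →ₐ[ℚ_[3]] PadicAlgCl 3 := IsAlgClosed.lift
    refine ⟨HodgeTateLabel.ofPadicAlgHom hcE σ', ?_⟩
    show wt (HodgeTateLabel.ofPadicAlgHom hcF (AlgHom.restrictDomain (w.adicCompletion F')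
        (HodgeTateLabel.equivPadicAlgHom hcE (HodgeTateLabel.ofPadicAlgHom hcE σ')))) j <
      wt (HodgeTateLabel.ofPadicAlgHom hcF (AlgHom.restrictDomain (w.adicCompletion F')
        (HodgeTateLabel.equivPadicAlgHom hcE (HodgeTateLabel.ofPadicAlgHom hcE σ')))) i
    have hlt : i < j := Fin.lt_def.2 (by omega)
    have := hgap (HodgeTateLabel.ofPadicAlgHom hcF (AlgHom.restrictDomain (w.adicCompletion F')
        (HodgeTateLabel.equivPadicAlgHom hcE (HodgeTateLabel.ofPadicAlgHom hcE σ')))) i j hlt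
    omega
  · -- ### the transport
    intro ρ U hord hU
    obtain ⟨t, ht⟩ := exists_toLocal_restrictField_eq_conj ρ w u
    obtain ⟨g, hg, hdiag⟩ := hord
    have h : (weilSubgroup (u.adicCompletion L)).map
        (absGaloisRestrict (w.adicCompletion F') (u.adicCompletion L)).toMonoidHom ≤
          weilSubgroup (w.adicCompletion F') :=
      WeilGroup.weilSubgroup_map_absGaloisRestrict_le_holds (w.adicCompletion F') (u.adicCompletion L)
    have hI := absInertia_map_absGaloisRestrict_le_holds (w.adicCompletion F') (u.adicCompletion L)
    have hcompat : (𝓐 F' w).IsCompatible (𝓐 L u) h :=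
      LocalArtinData.IsCanonical.isCompatible (h𝓐 F' w) (h𝓐 L u) h
    have key : ((ρ.restrictField L).toLocal u).conj (g * (ρ t)⁻¹) =
        ((ρ.toLocal w).conj g).comp (absGaloisRestrict (w.adicCompletion F') (u.adicCompletion L)) := by
      rw [ht, ← FramedRep.conj_mul_eq_conj_conj, inv_mul_cancel_right, FramedRep.conj_comp]
    refine ⟨g * (ρ t)⁻¹, ?_, fun τw hτw i => ?_⟩
    · rw [key]
      exact fun σ i j hij => hg _ i j hij
    · rw [key]
      have hmem : WeilGroup.map (w.adicCompletion F') (u.adicCompletion L) h τw ∈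
          WeilGroup.inertia (w.adicCompletion F') :=
        WeilGroup.map_inertia_le hI h ⟨τw, hτw, rfl⟩
      have hUm : WeilGroup.toAbsGalois (w.adicCompletion F')
          (WeilGroup.map (w.adicCompletion F') (u.adicCompletion L) h τw) ∈ U := hU _
      have hd := hdiag _ hmem hUm i
      change FramedRep.diagEntry ((ρ.toLocal w).conj g) i (WeilGroup.toAbsGalois (w.adicCompletion F')
        (WeilGroup.map (w.adicCompletion F') (u.adicCompletion L) h τw)) = _
      rw [hd, hcompat τw, ordinaryWeightUnit_unitsMap_norm hcF hcE wt i]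

end

end Summit.Langlands.Langlands.Cruxes.MuOrdinaryFamilyRT.ThorneMinimalLift
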